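import Summits.Langlands.Langlands.Theorems.ResiduallyYoshidaLifting.Negative.NumericalCriterionDVRWithoutFree

/-!
# `ResiduallyYoshidaLifting` (stmt-Langlands-13639) — Negative knowledge on STUB 2, III:
# surjectivity of `φ : A → B` is load-bearing in `stub_numericalCriterionDVR`

Deep-refute seat (gen 2) of the picked line `yoshida-divisor-selmer-count` (drefute, 2026-08-16),
companion of `Negative/NumericalCriterionDVRWithoutEta.lean` (`η ≠ ⊥` load-bearing) and
`Negative/NumericalCriterionDVRWithoutFree.lean` (`Module.Free O B` load-bearing).  STUB 2 is the
Wiles–Lenstra numerical criterion over a complete DVR with arbitrary residue field (de Smit–Rubin–Schoof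
1997, Criterion I: `R ↠ T` SURJECTIVE), TRUE in print; this file records, kernel-checked, that the
hypothesis `Function.Surjective φ` cannot be dropped (the gen-1 seat had it on paper only):

* `NumericalCriterionDVRWithoutSurjective` — the registered statement with `Function.Surjective φ →`
  deleted, everything else verbatim;
* `numericalCriterionDVR_false_without_surjective : ¬ NumericalCriterionDVRWithoutSurjective` — small
  model over `O = ℤ₂`: `A = ℤ₂` itself (complete Noetherian local), `B = ℤ₂[X]/(X² − 2X) ≅ ℤ₂ ×_{𝔽₂} ℤ₂`
  (local, finite FREE of rank 2, a complete intersection), `φ = algebraMap : ℤ₂ → B` (the structure map,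
  NOT surjective), `π : B → ℤ₂` evaluation at the root `0`.  Then `ker π = (x)`, `x − 2 ∈ Ann_B(ker π)`
  (as `x(x−2) = 0`), so `−2 ∈ η_B ≠ 0`; `𝔭_A = ker(π ∘ φ) = ker(id) = 0`, so `Φ_A = 0 ≤ Ψ_B`; and
  `φ` is not surjective (`x ∉ ℤ₂·1`: evaluate at the two roots `0` and `2`).

For the line this is hypothesis hygiene: in the intended instance `A = R_P^∧ ⊗ O ↠ B = T_P^∧ ⊗ O` the
map is surjective because `T` is generated by Hecke operators that are traces (values of the universal
pseudocharacter), which is part of the construction of `R → T` in STUB 1. [folklore]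
-/

noncomputable section

set_option linter.dupNamespace false

namespace Summit.Langlands.Langlands.Theorems.ResiduallyYoshidaLifting.Negative

open Polynomial IsLocalRing
open FreeWitness (two_not_isUnit)

/-- STUB 2 `stub_numericalCriterionDVR` of `Cruxes/ResiduallyYoshidaLifting/Lines/yoshida-divisor-selmer-count.lean`
(registered 2026-08-16T00:58:56Z, skeleton sha edead940…) with the hypothesis `Function.Surjective φ`
DROPPED and everything else verbatim. FALSE: `numericalCriterionDVR_false_without_surjective`. [folklore] -/
def NumericalCriterionDVRWithoutSurjective : Prop :=
  ∀ (O : Type) [CommRing O] [IsDomain O] [IsDiscreteValuationRing O]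
    [IsAdicComplete (IsLocalRing.maximalIdeal O) O]
    (A : Type) [CommRing A] [IsLocalRing A] [IsNoetherianRing A] [Algebra O A]
    [IsAdicComplete (IsLocalRing.maximalIdeal A) A]
    (B : Type) [CommRing B] [IsLocalRing B] [Algebra O B] [Module.Finite O B] [Module.Free O B]
    (φ : A →ₐ[O] B) (π : B →ₐ[O] O),
    Ideal.map (π : B →+* O) (RingHom.ker (π : B →+* O)).annihilator ≠ ⊥ →
    Module.length O (RingHom.ker ((π : B →+* O).comp (φ : A →+* B))).Cotangent ≤
      Module.length O (O ⧸ Ideal.map (π : B →+* O) (RingHom.ker (π : B →+* O)).annihilator) →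
    Function.Bijective φ

namespace SurjWitness

/-- The polynomial `X² − 2X ∈ ℤ₂[X]`. [folklore] -/
abbrev f : ℤ_[2][X] := X ^ 2 - C (2 : ℤ_[2]) * X

/-- `X² − 2X` is monic. [folklore] -/
theorem f_monic : f.Monic := by
  refine (monic_X_pow 2).sub_of_left ((degree_C_mul_X_le (2 : ℤ_[2])).trans_lt ?_)
  rw [degree_X_pow]
  exact WithBot.coe_lt_coe.2 (by norm_num)

/-- `natDegree (X² − 2X) = 2`. [folklore] -/
theorem natDegree_f : f.natDegree = 2 := by
  rw [natDegree_sub_eq_left_of_natDegree_lt] <;> rw [natDegree_X_pow]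
  exact ((natDegree_C_mul_le (2 : ℤ_[2]) X).trans natDegree_X_le).trans_lt (by norm_num)

/-- The Hecke side `B = ℤ₂[X]/(X² − 2X) ≅ ℤ₂ ×_{𝔽₂} ℤ₂` (finite free of rank 2, local). [folklore] -/
abbrev B : Type := AdjoinRoot f

/-- `B` is free over `ℤ₂` (power basis `1, x`). [folklore] -/
instance : Module.Free ℤ_[2] B := f_monic.free_adjoinRoot

/-- `B` is module-finite over `ℤ₂`. [folklore] -/
instance : Module.Finite ℤ_[2] B := f_monic.finite_adjoinRoot

/-- `B` is non-trivial (`deg f ≠ 0`). [folklore] -/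
instance : Nontrivial B :=
  AdjoinRoot.nontrivial f (by
    rw [degree_eq_natDegree f_monic.ne_zero, natDegree_f]
    exact fun h => by cases h)

/-- Every element of `B` is `a + b·x` with `a, b ∈ ℤ₂` (division by the monic `f`). [folklore] -/
theorem exists_rep (y : B) : ∃ a b : ℤ_[2], y = AdjoinRoot.mk f (C a + C b * X) := by
  induction y using AdjoinRoot.induction_on with
  | ih g =>
    refine ⟨(g %ₘ f).coeff 0, (g %ₘ f).coeff 1, ?_⟩
    have hdeg : (g %ₘ f).natDegree ≤ 1 := by
      have h := natDegree_modByMonic_lt g f_monic (fun h1 => by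
        have := congrArg natDegree h1
        rw [natDegree_f, natDegree_one] at this
        exact absurd this (by norm_num))
      rw [natDegree_f] at h
      omega
    have hrep : g %ₘ f = C ((g %ₘ f).coeff 0) + C ((g %ₘ f).coeff 1) * X := by
      conv_lhs => rw [eq_X_add_C_of_natDegree_le_one hdeg]
      ring
    rw [← hrep, AdjoinRoot.mk_eq_mk]
    exact ⟨g /ₘ f, by linear_combination (modByMonic_add_div g f).symm⟩

/-- Units of `B`: if `a ∈ ℤ₂ˣ` then `a + b·x` is a unit, with inverse `a⁻¹ − b a⁻¹ (a+2b)⁻¹ · x`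
(`x² = 2x`). [folklore] -/
theorem isUnit_mk_of_isUnit {a : ℤ_[2]} (b : ℤ_[2]) (ha : IsUnit a) :
    IsUnit (AdjoinRoot.mk f (C a + C b * X)) := by
  -- `a + 2b` is a unit of the local ring `ℤ₂`
  have hu : IsUnit (a + 2 * b) := by
    by_contra hnu
    have h2b : 2 * b ∈ nonunits ℤ_[2] := by
      rw [mem_nonunits_iff]
      exact fun h => two_not_isUnit (isUnit_of_mul_isUnit_left h)
    have : a + 2 * b + -(2 * b) ∈ nonunits ℤ_[2] :=
      nonunits_add hnu (by rwa [mem_nonunits_iff, IsUnit.neg_iff, ← mem_nonunits_iff])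
    rw [add_neg_cancel_right] at this
    exact this ha
  obtain ⟨c, hc⟩ := ha.exists_right_inv
  obtain ⟨e, he⟩ := hu.exists_right_inv
  -- inverse `c + d x` with `d = -(b c e)`:
  set d : ℤ_[2] := -(b * c * e) with hd
  have h2 : a * d + b * c + 2 * b * d = 0 := by
    have : a * d + b * c + 2 * b * d = b * c * (1 - (a + 2 * b) * e) := by rw [hd]; ring
    rw [this, he, sub_self, mul_zero]
  refine IsUnit.of_mul_eq_one (AdjoinRoot.mk f (C c + C d * X)) ?_
  rw [← map_mul, ← map_one (AdjoinRoot.mk f), AdjoinRoot.mk_eq_mk]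
  refine ⟨C b * C d, ?_⟩
  have h1' : C a * C c = (1 : ℤ_[2][X]) := by rw [← C_mul, hc, C_1]
  have h2' : C a * C d + C b * C c + C 2 * C b * C d = (0 : ℤ_[2][X]) := by
    rw [← C_mul, ← C_mul, ← C_mul, ← C_mul, ← C_add, ← C_add, h2, C_0]
  linear_combination h1' + X * h2'

/-- `B` is a local ring: `a + b x` is a unit iff `a` is, and `ℤ₂` is local. [folklore] -/
instance : IsLocalRing B := by
  refine IsLocalRing.of_isUnit_or_isUnit_one_sub_self fun y => ?_
  obtain ⟨a, b, rfl⟩ := exists_rep y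
  rcases IsLocalRing.isUnit_or_isUnit_one_sub_self a with ha | ha
  · exact Or.inl (isUnit_mk_of_isUnit b ha)
  · right
    have : (1 : B) - AdjoinRoot.mk f (C a + C b * X) = AdjoinRoot.mk f (C (1 - a) + C (-b) * X) := by
      rw [← map_one (AdjoinRoot.mk f), ← map_sub]
      congr 1
      rw [C_sub, C_1, C_neg]
      ring
    rw [this]
    exact isUnit_mk_of_isUnit (-b) ha

/-- The augmentation `π : B → ℤ₂`, `x ↦ 0` (a root of `f`). [folklore] -/
def πB : B →ₐ[ℤ_[2]] ℤ_[2] :=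
  AdjoinRoot.liftAlgHom f (Algebra.ofId ℤ_[2] ℤ_[2]) 0 (by simp)

/-- The second evaluation `π₂ : B → ℤ₂`, `x ↦ 2` (the other root of `f`). [folklore] -/
def π₂ : B →ₐ[ℤ_[2]] ℤ_[2] :=
  AdjoinRoot.liftAlgHom f (Algebra.ofId ℤ_[2] ℤ_[2]) 2 (by simp; ring)

/-- `π` on a class: evaluation at `0`. [folklore] -/
theorem πB_mk (g : ℤ_[2][X]) : πB (AdjoinRoot.mk f g) = g.eval 0 := by
  rw [πB, AdjoinRoot.liftAlgHom_mk]
  simp [coeff_zero_eq_eval_zero]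

/-- `π₂` on a class: evaluation at `2`. [folklore] -/
theorem π₂_mk (g : ℤ_[2][X]) : π₂ (AdjoinRoot.mk f g) = g.eval 2 := by
  rw [π₂, AdjoinRoot.liftAlgHom_mk]
  simp

/-- The deformation side is `A = ℤ₂` itself and `φ = algebraMap : ℤ₂ → B` (NOT surjective). [folklore] -/
def φ : ℤ_[2] →ₐ[ℤ_[2]] B := Algebra.ofId ℤ_[2] B

/-- `φ` is not surjective: `x` is not in `ℤ₂ · 1` (evaluate at the roots `0` and `2`). [folklore] -/
theorem φ_not_surjective : ¬ Function.Surjective φ := by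
  intro h
  obtain ⟨c, hc⟩ := h (AdjoinRoot.root f)
  have h0 : c = 0 := by
    have := congrArg πB hc
    rwa [φ, Algebra.ofId_apply, AlgHom.commutes, AdjoinRoot.root, πB_mk, eval_X,
      Algebra.algebraMap_self_apply] at this
  have h2 : c = 2 := by
    have := congrArg π₂ hc
    rwa [φ, Algebra.ofId_apply, AlgHom.commutes, AdjoinRoot.root, π₂_mk, eval_X,
      Algebra.algebraMap_self_apply] at this
  rw [h0] at h2
  exact two_ne_zero h2.symm

/-- `η_B ≠ ⊥`: `x − 2 ∈ Ann_B(ker π)` (since `ker π = (x)` and `x(x−2) = 0`), and `π(x − 2) = −2 ≠ 0`. [folklore] -/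
theorem eta_ne_bot :
    Ideal.map (πB : B →+* ℤ_[2]) (RingHom.ker (πB : B →+* ℤ_[2])).annihilator ≠ ⊥ := by
  have hann : (AdjoinRoot.mk f (X - C 2) : B) ∈ (RingHom.ker (πB : B →+* ℤ_[2])).annihilator := by
    rw [Submodule.mem_annihilator]
    intro y hy
    obtain ⟨a, b, rfl⟩ := exists_rep y
    have ha : a = 0 := by
      have : πB (AdjoinRoot.mk f (C a + C b * X)) = 0 := hy
      rw [πB_mk] at this
      simpa using this
    subst ha
    rw [smul_eq_mul, ← map_mul, AdjoinRoot.mk_eq_zero]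
    exact ⟨C b, by rw [C_0]; ring⟩
  have hm2 : (-2 : ℤ_[2]) ∈
      Ideal.map (πB : B →+* ℤ_[2]) (RingHom.ker (πB : B →+* ℤ_[2])).annihilator := by
    have := Ideal.mem_map_of_mem (πB : B →+* ℤ_[2]) hann
    rw [AlgHom.coe_toRingHom, πB_mk] at this
    simpa using this
  intro hbot
  rw [hbot, Ideal.mem_bot, neg_eq_zero] at hm2
  exact two_ne_zero hm2

/-- `𝔭_A = ker(π ∘ φ) = 0` in `A = ℤ₂` (the composite is the identity), so `Φ_A = 0`. [folklore] -/
theorem length_cotangent_eq_zero :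
    Module.length ℤ_[2] (RingHom.ker ((πB : B →+* ℤ_[2]).comp (φ : ℤ_[2] →+* B))).Cotangent = 0 := by
  rw [Module.length_eq_zero_iff]
  have hker : ∀ a ∈ RingHom.ker ((πB : B →+* ℤ_[2]).comp (φ : ℤ_[2] →+* B)), a = 0 := by
    intro a ha
    rw [RingHom.mem_ker, RingHom.comp_apply, AlgHom.coe_toRingHom, AlgHom.coe_toRingHom, φ,
      Algebra.ofId_apply, AlgHom.commutes, Algebra.algebraMap_self_apply] at ha
    exact ha
  haveI : Subsingleton (RingHom.ker ((πB : B →+* ℤ_[2]).comp (φ : ℤ_[2] →+* B))) :=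
    ⟨fun x y => Subtype.ext ((hker x x.2).trans (hker y y.2).symm)⟩
  exact (Ideal.toCotangent_surjective _).subsingleton

end SurjWitness

open SurjWitness in
/-- **`Function.Surjective φ` is load-bearing in STUB 2** (`stub_numericalCriterionDVR`): with the
hypothesis `Function.Surjective φ` dropped the numerical criterion is FALSE — witness `A = ℤ₂`,
`B = ℤ₂[X]/(X² − 2X)` (local, free of rank 2), `φ = algebraMap`, `π = ` evaluation at `0`:
`η_B ∋ −2 ≠ 0`, `Φ_A = 0 ≤ Ψ_B`, and `φ` is not surjective.  (de Smit–Rubin–Schoof, Criterion I, is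
stated for a SURJECTION `R ↠ T`; without it `Φ_R` does not dominate `Φ_T`.)  Any proof of the stub
must use surjectivity. [folklore] -/
theorem numericalCriterionDVR_false_without_surjective : ¬ NumericalCriterionDVRWithoutSurjective := by
  intro h
  exact φ_not_surjective (h ℤ_[2] ℤ_[2] B φ πB eta_ne_bot (length_cotangent_eq_zero.le.trans bot_le)).2

end Summit.Langlands.Langlands.Theorems.ResiduallyYoshidaLifting.Negative

end
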